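import Summits.BirchSwinnertonDyer.BirchSwinnertonDyer.Theorems.QuadraticBranchSignedControlEtaTransportTowerDecomposition
import Summits.BirchSwinnertonDyer.BirchSwinnertonDyer.Theorems.QuadraticBranchSignedControlEtaTransportCharacter
import Summits.BirchSwinnertonDyer.BirchSwinnertonDyer.Theorems.QuadraticBranchSignedControlEtaTransportTowerTransfer
import Summits.BirchSwinnertonDyer.Rank1Residual.Additive.SignedTwistOddBranchReadings
import Summits.BirchSwinnertonDyer.Rank1Residual.Additive.QuadraticTowerRestrict
import HarnessLib

/-!
# Route `QuadraticBranchSignedControl` (rung K8, cell `bsd-potss`), crux `EtaTransportSigned`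
# (item stmt-BirchSwinnertonDyer-19115), stub `stub_etaMC_plus`: the decomposition frame `hdec`
# REDUCED to two comparison isomorphisms — (A) `F`-internal ↔ `ℚ`-internal and (i-f) the local
# model transfer at `p` — by assembling the landed bricks (B1), (B2⁰), (B3), (U)

WHAT. `Theorems/QuadraticBranchSignedControlEtaTransportPlusOfDecomposition.lean` proves the plus
conjunct of the crux (registered stub `stub_etaMC_plus`) from ONE displayed frame `hdec`: a
Γ-equivariant additive isomorphism `Sel⁺(V'/F_∞) ≃ Sel⁺(V/ℚ_∞) × Sel⁺(V/K₀ℚ_∞)^η` for some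
(C1_η)-admissible quadratic model (`F ∋ √p*`, `V' ≅ V_F`, `κF`, `γF`). THIS FILE proves `hdec`
(verbatim) from TWO smaller displayed frames, both pure comparison statements between EXISTING tree
objects, and nothing else:
* (A) `hA` — ctrl's piece (i-c): for the stub's binders, a quadratic field `F ∋ θ_F` (`θ_F² = p*`,
  `θ_F ∉ ℚ`), an `F`-model `V'` of `V`, a cyclotomic `ℤ_p`-extension `κF` of `F` with generator `γF`
  (cyclotomic-variable clause; `γ⁻¹·γF|_{ℚ̄} ∈ ker κ`), and an additive isomorphism
  `Ψ_A : Sel⁺(V'/F_∞^{κF})` [Kobayashi Def. 1.1 INSIDE `Γ_F`, `Kobayashi2003.signedSelmerInfty V' κF 1`]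
  `≃ Sel⁺(V/Fℚ_∞)` [cc-typer-6's tower object INSIDE `Γ_ℚ` at the model `ℚ_[p]`,
  `towerSignedSelmerInfty V κ F ℚ_[p] 1`] intertwining `conj_{γF}` with `conj_{γF|_{ℚ̄}}`;
* (i-f) `hIF` — the local model transfer at `p` on the `ℚ`-side:
  `Kobayashi2003.signedSelmerInfty V κ 1 = strictSignedSelmerInfty V κ ℚ_[p] 1` (Def. 1.1 plus
  condition read at `(p).adicCompletion ℚ` versus at `ℚ_[p]`; both are additive subgroups of
  `H¹(Gal(ℚ̄/ℚ_∞), V[p^∞])`). Its first half — `= strictSignedSelmerInfty V κ ℚ_{v₀} 1` at the adic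
  model — is the tree theorem `signedSelmerInfty_one_eq_strictSignedSelmerInfty_adicCompletion`
  (`…EtaTransportSelmerAdicModel.lean`); the remaining content is the change of model `ℚ_{v₀} ≃ ℚ_[p]`
  (`…EtaTransportLocalModelChange.lean` has the local half: layer subgroups / points / traces /
  signed points correspond).
Everything else is PROVED: the quadratic-field bookkeeping (§1: for ANY quadratic `F ∋ θ_F` with
`θ_F² = p*` — `Gal(ℚ̄/F)` is the fixer of `√p* ∈ ℚ̄`, `= ker ηq` on the nose by brick (U);
`Gal(ℚ̄/K₀) ≤ Gal(ℚ̄/F)`; the (P5) binders `hD`/`hκ₀`/`hcop` for `F`; an element of `ker κ` on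
which `ηq = −1`), the `η`-eigen-decomposition `Sel⁺(V/Fℚ_∞) ≃ Sel⁺(V/Fℚ_∞)^1 × Sel⁺(V/Fℚ_∞)^η`
(brick (B1)), `Sel⁺(V/Fℚ_∞)^1 ≃ Sel⁺(V/ℚ_∞)` at `ℚ_[p]` (brick (B2⁰) = ctrl's (i-e), with the twist
partner `W = V^{(p*)}`), `Sel⁺(V/Fℚ_∞)^η ≃ Sel⁺(V/K₀ℚ_∞)^η` (brick (B3) = (D3⁺) at `F` and at `K₀`),
and the Γ-equivariance bookkeeping `conj_{γF|} = conj_γ` on both targets (`γ⁻¹γF| ∈ ker κ ∩ ker ηq`).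

HONEST FRAMING (cell `bsd-potss`, run/shared/lean/pub/bsd-potss/; FULL-BSD rank ≤ 1 programme):
TOOL THEOREMS ONLY — no definition, no named Literature fact, no `sorry`, axioms standard.
`hdec_of_frames` is CONDITIONAL on the two displayed frames `hA`, `hIF` (WANTED: (A) = ctrl memo
v7 §2j (i-c) «THE LONG POLE», (i-f) = x1b file-76-pattern model transport); §1 is unconditional.
Nothing about (C1_η), Kobayashi's theorems or `BSD(W, p)` is claimed; no label or count moves.
Seat `bsd-potss-k8q-c3` (prover), g0.

References: [Kobayashi2003] Def. 1.1 (p. 2), Def. 2.1 (p. 5), §2 p. 4, §4 p. 8 (`X⁺(E/K_∞)^η`;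
`M = ⊕ M^η`); [GreenbergLNM1716] §3; [Washington1997] §13.1; [SerreGaloisCohomology1997] I.§2.5,
II.§1.1.
-/

set_option autoImplicit false
set_option linter.dupNamespace false

noncomputable section

open scoped Classical

open Field WeierstrassCurve NumberField IsDedekindDomain
open Literature.NumberTheory.EllipticCurves
open Literature.NumberTheory.GaloisRepresentations
open Summit.BirchSwinnertonDyer.Rank1Residual.Additive
open Summit.BirchSwinnertonDyer.Rank1Residual.Additive.SignedTwist
open Summit.BirchSwinnertonDyer.Rank1Residual.AdditivePotMult

namespace Summit.BirchSwinnertonDyer.BirchSwinnertonDyer.Theorems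

/-! ## §1 A quadratic field `F ∋ √c` against `K₀ = ℚ(μ_p) ∋ √c` -/

section QuadraticField

variable (p : ℕ) [Fact p.Prime] (K₀ : Type) [Field K₀] [NumberField K₀]
  (ηq : absoluteGaloisGroup ℚ →* ℤˣ)
  (F : Type) [Field F] [NumberField F] {θF : F} {θ₀ : K₀} {c : ℚ}

/-- For a QUADRATIC field `F = ℚ(θ_F)`, `θ_F² = c`, `θ_F ∉ ℚ`: `σ ∈ Gal(ℚ̄/F)` iff `σ` fixes
`t_F = √c ∈ ℚ̄` (additive-p1's sign rule `apply_rootInClosure_of_(not_)mem`). [folklore] -/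
theorem mem_galRange_iff_smul_rootInClosure_of_finrank_eq_two (h2 : Module.finrank ℚ F = 2)
    (hθF : θF ∉ Set.range (algebraMap ℚ F)) (hcF : θF ^ 2 = algebraMap ℚ F c)
    (σ : absoluteGaloisGroup ℚ) :
    σ ∈ galRange (K := ℚ) F ↔ σ • rootInClosure F θF = rootInClosure F θF := by
  constructor
  · exact fun h => apply_rootInClosure_of_mem F h
  · intro h
    by_contra hσ
    exact rootInClosure_ne_neg F hθF (h.symm.trans (apply_rootInClosure_of_not_mem F h2 hθF hcF hσ))

/-- Two square roots of the same `c` in `ℚ̄` have the same fixer: `σ t_F = t_F ↔ σ t₀ = t₀`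
(`t_F = ±t₀`). [folklore] -/
theorem smul_rootInClosure_eq_iff_of_sq_eq (hcF : θF ^ 2 = algebraMap ℚ F c)
    (hc₀ : θ₀ ^ 2 = algebraMap ℚ K₀ c) (σ : absoluteGaloisGroup ℚ) :
    σ • rootInClosure F θF = rootInClosure F θF ↔ σ • rootInClosure K₀ θ₀ = rootInClosure K₀ θ₀ := by
  have hsq : rootInClosure F θF ^ 2 = rootInClosure K₀ θ₀ ^ 2 := by
    rw [rootInClosure_sq F hcF, rootInClosure_sq K₀ hc₀]
  rcases sq_eq_sq_iff_eq_or_eq_neg.mp hsq with h | h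
  · rw [h]
  · rw [h, smul_neg, neg_inj]

/-- **The crux's `ηq` is trivial EXACTLY on the fixer of `t_F = √c`** for any quadratic-type
`θ_F ∈ F` with `θ_F² = c` when `K₀ = ℚ(μ_p)` contains a square root `θ₀` of `c` (brick (U) at `K₀`,
then `t_F = ±t₀`). [cite: Kobayashi2003, §4 p. 8 (η the character of ℚ(√p*) ⊂ ℚ(μ_p))] -/
theorem eta_eq_one_iff_smul_rootInClosure_of_sq_eq [IsCyclotomicExtension {p} ℚ K₀]
    [(galRange (K := ℚ) K₀).Normal] (hηK : ∀ σ ∈ galRange (K := ℚ) K₀, ηq σ = 1)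
    (hη1 : ηq ≠ 1) (hcF : θF ^ 2 = algebraMap ℚ F c) (hθ₀ : θ₀ ∉ Set.range (algebraMap ℚ K₀))
    (hc₀ : θ₀ ^ 2 = algebraMap ℚ K₀ c) (σ : absoluteGaloisGroup ℚ) :
    ηq σ = 1 ↔ σ • rootInClosure F θF = rootInClosure F θF := by
  rw [smul_rootInClosure_eq_iff_of_sq_eq K₀ F hcF hc₀,
    eta_eq_one_iff_smul_rootInClosure p K₀ hθ₀ hc₀ ηq hηK hη1]

/-- `Gal(ℚ̄/F) = ker ηq` for a quadratic `F ∋ √c`, `√c ∈ K₀`. [cite: Kobayashi2003, §4 p. 8] -/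
theorem mem_galRange_iff_eta_eq_one [IsCyclotomicExtension {p} ℚ K₀] [(galRange (K := ℚ) K₀).Normal]
    (h2 : Module.finrank ℚ F = 2)
    (hθF : θF ∉ Set.range (algebraMap ℚ F)) (hcF : θF ^ 2 = algebraMap ℚ F c)
    (hηK : ∀ σ ∈ galRange (K := ℚ) K₀, ηq σ = 1) (hη1 : ηq ≠ 1)
    (hθ₀ : θ₀ ∉ Set.range (algebraMap ℚ K₀)) (hc₀ : θ₀ ^ 2 = algebraMap ℚ K₀ c)
    (σ : absoluteGaloisGroup ℚ) : σ ∈ galRange (K := ℚ) F ↔ ηq σ = 1 := by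
  rw [mem_galRange_iff_smul_rootInClosure_of_finrank_eq_two F h2 hθF hcF,
    eta_eq_one_iff_smul_rootInClosure_of_sq_eq p K₀ ηq F hηK hη1 hcF hθ₀ hc₀]

/-- `Gal(ℚ̄/K₀) ≤ Gal(ℚ̄/F)` (`F = ℚ(√c) ⊂ K₀`). [cite: Kobayashi2003, §4 p. 8] -/
theorem galRange_le_galRange_of_sq_eq [IsCyclotomicExtension {p} ℚ K₀]
    [(galRange (K := ℚ) K₀).Normal] (h2 : Module.finrank ℚ F = 2)
    (hθF : θF ∉ Set.range (algebraMap ℚ F)) (hcF : θF ^ 2 = algebraMap ℚ F c)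
    (hηK : ∀ σ ∈ galRange (K := ℚ) K₀, ηq σ = 1) (hη1 : ηq ≠ 1)
    (hθ₀ : θ₀ ∉ Set.range (algebraMap ℚ K₀)) (hc₀ : θ₀ ^ 2 = algebraMap ℚ K₀ c) :
    galRange (K := ℚ) K₀ ≤ galRange (K := ℚ) F := fun σ hσ =>
  (mem_galRange_iff_eta_eq_one p K₀ ηq F h2 hθF hcF hηK hη1 hθ₀ hc₀ σ).mpr (hηK σ hσ)

/-- `ηq` is non-trivial on `ker κ` (`F ⊄ ℚ_∞`: `κ` is onto on `Gal(ℚ̄/F)` as `p ∤ 2 = [F:ℚ]`, and some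
`g ∈ Γ_ℚ` moves `√c`). [cite: Washington1997, §13.1] -/
theorem exists_mem_kerSubgroup_eta_ne_one [IsCyclotomicExtension {p} ℚ K₀]
    [(galRange (K := ℚ) K₀).Normal] (κ : ZpExtension ℚ p) (hp2 : p ≠ 2)
    (h2 : Module.finrank ℚ F = 2) (hθF : θF ∉ Set.range (algebraMap ℚ F))
    (hcF : θF ^ 2 = algebraMap ℚ F c) (hηK : ∀ σ ∈ galRange (K := ℚ) K₀, ηq σ = 1) (hη1 : ηq ≠ 1)
    (hθ₀ : θ₀ ∉ Set.range (algebraMap ℚ K₀)) (hc₀ : θ₀ ^ 2 = algebraMap ℚ K₀ c) :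
    ∃ τ ∈ κ.kerSubgroup, ηq τ ≠ 1 := by
  obtain ⟨g, hg⟩ := exists_smul_rootInClosure_ne F hθF
  haveI : IsGalois ℚ F := isGalois_of_finrank_eq_two F h2
  have hcopF : p.Coprime (Module.finrank ℚ F) := by
    rw [h2]; exact (Nat.coprime_primes (Fact.out : p.Prime) Nat.prime_two).mpr hp2
  obtain ⟨h, hh, hκh⟩ := kappa_surjOn_galRange_of_coprime_finrank κ F hcopF (κ g)
  refine ⟨g * h⁻¹, by rw [ZpExtension.mem_kerSubgroup, map_mul, map_inv, hκh, mul_inv_cancel], ?_⟩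
  have hηh : ηq h = 1 := (mem_galRange_iff_eta_eq_one p K₀ ηq F h2 hθF hcF hηK hη1 hθ₀ hc₀ h).mp hh
  rw [map_mul, map_inv, hηh, inv_one, mul_one, Ne,
    eta_eq_one_iff_smul_rootInClosure_of_sq_eq p K₀ ηq F hηK hη1 hcF hθ₀ hc₀]
  exact hg

/-- The (P5) local binder (D0) for `F`: the decomposition group at `ℚ_[p]` surjects onto
`Gal(Fℚ_∞/ℚ)` — from the cyclotomic case (`localTowerHyp_padic`) and `Gal(ℚ̄/K₀) ≤ Gal(ℚ̄/F)`.
[cite: Kobayashi2003, §2 p. 4 (p totally ramified in K_n)] -/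
theorem localTowerHyp_padic_of_sq_eq [IsCyclotomicExtension {p} ℚ K₀]
    [(galRange (K := ℚ) K₀).Normal] (κ : ZpExtension ℚ p) (hκ : κ.IsCyclotomic)
    (h2 : Module.finrank ℚ F = 2) (hθF : θF ∉ Set.range (algebraMap ℚ F))
    (hcF : θF ^ 2 = algebraMap ℚ F c) (hηK : ∀ σ ∈ galRange (K := ℚ) K₀, ηq σ = 1) (hη1 : ηq ≠ 1)
    (hθ₀ : θ₀ ∉ Set.range (algebraMap ℚ K₀)) (hc₀ : θ₀ ^ 2 = algebraMap ℚ K₀ c)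
    (g : absoluteGaloisGroup ℚ) :
    ∃ τ : absoluteGaloisGroup ℚ_[p],
      (resGalOfEmb (closureEmb (K := ℚ) ℚ_[p]) τ)⁻¹ * g ∈ towerTopSubgroup κ F := by
  obtain ⟨τ, hτ⟩ := localTowerHyp_padic p κ K₀ hκ g
  exact ⟨τ, inf_le_inf_left _
    (galRange_le_galRange_of_sq_eq p K₀ ηq F h2 hθF hcF hηK hη1 hθ₀ hc₀) hτ⟩

end QuadraticField

/-! ## §2 The twist partner `W = V^{(c)}` -/

/-- For `c ≠ 0`: `V` is (a model of) the `c`-twist of its own `c`-twist `W = V^{(c)}`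
(`(V^{(c)})^{(c)} = V^{(c²)} ≅ V`). [folklore] -/
theorem exists_variableChange_twist_twist (V : WeierstrassCurve ℚ) {c : ℚ} (hc : c ≠ 0) :
    ∃ C : VariableChange ℚ, C • (V.quadraticTwist c).quadraticTwist c = V := by
  obtain ⟨C₀, hC₀⟩ := V.exists_variableChange_smul_eq_quadraticTwist_sq (θ := c) hc
  refine ⟨C₀⁻¹, ?_⟩
  rw [quadraticTwist_quadraticTwist, ← sq, ← hC₀, inv_smul_smul]

/-- Unfolding a composite `Ψ_A ≫ Ψ₁⁻¹ ≫ (f × g)` of additive isomorphisms (stated abstractly so that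
no Selmer-group definition is unfolded when it is used). [folklore] -/
theorem addEquiv_trans_symm_trans_prodCongr_apply {A T T₁ T₂ S₁ S₂ : Type*} [AddCommGroup A]
    [AddCommGroup T] [AddCommGroup T₁] [AddCommGroup T₂] [AddCommGroup S₁] [AddCommGroup S₂]
    (ΨA : A ≃+ T) (Ψ₁ : T₁ × T₂ ≃+ T) (f : T₁ ≃+ S₁) (g : T₂ ≃+ S₂) (x : A) :
    (ΨA.trans (Ψ₁.symm.trans (AddEquiv.prodCongr f g))) x =
      (f (Ψ₁.symm (ΨA x)).1, g (Ψ₁.symm (ΨA x)).2) :=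
  rfl

/-! ## §3 The frame `hdec` from (A) and (i-f) -/

/-- **The decomposition frame `hdec` of `etaTransportPlus_of_decomposition` FROM the two
comparison frames (A) and (i-f)** (everything else assembled from landed bricks). Given the
stub's binders: take `(F, θ_F, V', κF, γF, Ψ_A)` from `hA`; `√p* ∈ K₀` (Gauss,
`exists_sq_eq_pStar`); `ker ηq = Gal(ℚ̄/F)` (§1, brick (U)); the twist partner `W = V^{(p*)}`;
`Ψ₁ : Sel⁺(V/Fℚ_∞)^1 × Sel⁺(V/Fℚ_∞)^η ≃ Sel⁺(V/Fℚ_∞)` (brick (B1)); `Ψ₂ : Sel⁺(V/ℚ_∞)_{ℚ_p} ≃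
Sel⁺(V/Fℚ_∞)^1` (brick (B2⁰)); `Sel⁺(V/ℚ_∞) = Sel⁺(V/ℚ_∞)_{ℚ_p}` (`hIF`); `Ψ₃ : Sel⁺(V/Fℚ_∞)^η ≃
Sel⁺(V/K₀ℚ_∞)^η` (brick (B3)); `Φ = (Ψ₂⁻¹ × Ψ₃) ∘ Ψ₁⁻¹ ∘ Ψ_A`. Equivariance: `Ψ_A` turns `conj_{γF}`
into `conj_{g'}`, `g' = γF|_{ℚ̄}`; the bricks commute with `conj_{g'}`; and `conj_{g'} = conj_γ` on
`H¹(Gal(ℚ̄/ℚ_∞), ·)` (`γ⁻¹g' ∈ ker κ` acts trivially) and on `Sel⁺(V/K₀ℚ_∞)^η` (`γ⁻¹g'` acts by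
`ηq(γ⁻¹g') = 1`: `γ ∈ Gal(ℚ̄/K₀)`, `g' ∈ Gal(ℚ̄/F) = ker ηq`). CONDITIONAL on `hA`, `hIF`.
[cite: Kobayashi2003, §4 p. 8 (X⁺(E/K_∞)^η; M = ⊕ M^η), Def. 1.1 (p. 2), Def. 2.1 (p. 5)]
[cite: GreenbergLNM1716, §3] -/
theorem etaDecomposition_of_frames
    (hA : ∀ (p : ℕ) [Fact p.Prime], 5 ≤ p →
      ∀ (K₀ : Type) [Field K₀] [NumberField K₀] [IsCyclotomicExtension {p} ℚ K₀]
        [(galRange (K := ℚ) K₀).Normal] (ηq : absoluteGaloisGroup ℚ →* ℤˣ),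
        (∀ σ ∈ galRange (K := ℚ) K₀, ηq σ = 1) → ηq ≠ 1 →
      ∀ (V : WeierstrassCurve ℚ) [V.IsElliptic] [V.IsGloballyMinimal],
        V.HasGoodReductionAtPrime p → V.frobeniusTrace p = 0 →
      ∀ (κ : ZpExtension ℚ p) (γ : absoluteGaloisGroup ℚ),
        κ.IsCyclotomic → κ.IsTopGenerator γ → γ ∈ galRange (K := ℚ) K₀ →
        IsCyclotomicVariable p γ →
      ∃ (F : Type) (_ : Field F) (_ : NumberField F) (_ : (galRange (K := ℚ) F).Normal) (θF : F)
        (V' : WeierstrassCurve F) (_ : V'.IsElliptic) (κF : ZpExtension F p)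
        (γF : absoluteGaloisGroup F)
        (ΨA : Kobayashi2003.signedSelmerInfty V' κF 1 ≃+ towerSignedSelmerInfty V κ F ℚ_[p] 1),
        Module.finrank ℚ F = 2 ∧ θF ∉ Set.range (algebraMap ℚ F) ∧
        θF ^ 2 = algebraMap ℚ F ((-1) ^ (p / 2) * p) ∧
        (∃ C : VariableChange F, C • V.baseChange F = V') ∧
        κF.IsCyclotomic ∧ κF.IsTopGenerator γF ∧
        (∃ ζ : ℤ_[p]ˣ, IsOfFinOrder ζ ∧
          ((GaloisRep.cyclotomicCharacter F p γF * ζ : ℤ_[p]ˣ) : ℤ_[p]) =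
            (cyclotomicGenerator p : ℤ_[p])) ∧
        γ⁻¹ * resGal (K := ℚ) F γF ∈ κ.kerSubgroup ∧
        ∀ s : Kobayashi2003.signedSelmerInfty V' κF 1,
          ((ΨA ⟨V'.conjH1 p κF.kerSubgroup γF s,
              Kobayashi2003.conjH1_mem_signedSelmerInfty V' κF 1 γF s.2⟩ :
              towerSignedSelmerInfty V κ F ℚ_[p] 1) : V.subgroupH1 p (towerTopSubgroup κ F)) =
            V.conjH1 p (towerTopSubgroup κ F) (resGal (K := ℚ) F γF) (ΨA s))
    (hIF : ∀ (p : ℕ) [Fact p.Prime], 5 ≤ p →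
      ∀ (V : WeierstrassCurve ℚ) [V.IsElliptic] [V.IsGloballyMinimal],
        V.HasGoodReductionAtPrime p → V.frobeniusTrace p = 0 →
      ∀ (κ : ZpExtension ℚ p), κ.IsCyclotomic →
        Kobayashi2003.signedSelmerInfty V κ 1 = strictSignedSelmerInfty V κ ℚ_[p] 1) :
    ∀ (p : ℕ) [Fact p.Prime], 5 ≤ p →
      ∀ (K₀ : Type) [Field K₀] [NumberField K₀] [IsCyclotomicExtension {p} ℚ K₀]
        [(galRange (K := ℚ) K₀).Normal] (ηq : absoluteGaloisGroup ℚ →* ℤˣ),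
        (∀ σ ∈ galRange (K := ℚ) K₀, ηq σ = 1) → ηq ≠ 1 →
      ∀ (V : WeierstrassCurve ℚ) [V.IsElliptic] [V.IsGloballyMinimal],
        V.HasGoodReductionAtPrime p → V.frobeniusTrace p = 0 →
      ∀ (κ : ZpExtension ℚ p) (γ : absoluteGaloisGroup ℚ),
        κ.IsCyclotomic → κ.IsTopGenerator γ → γ ∈ galRange (K := ℚ) K₀ →
        IsCyclotomicVariable p γ →
      ∃ (F : Type) (_ : Field F) (_ : NumberField F) (V' : WeierstrassCurve F) (_ : V'.IsElliptic)
        (κF : ZpExtension F p) (γF : absoluteGaloisGroup F)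
        (Φ : Kobayashi2003.signedSelmerInfty V' κF 1 ≃+
          Kobayashi2003.signedSelmerInfty V κ 1 × towerSignedSelmerInftyEta V κ K₀ ℚ_[p] ηq 1),
        Module.finrank ℚ F = 2 ∧ (∃ θ : F, θ ^ 2 = algebraMap ℚ F ((-1) ^ (p / 2) * p)) ∧
        (∃ C : VariableChange F, C • V.baseChange F = V') ∧
        κF.IsCyclotomic ∧ κF.IsTopGenerator γF ∧
        (∃ ζ : ℤ_[p]ˣ, IsOfFinOrder ζ ∧
          ((GaloisRep.cyclotomicCharacter F p γF * ζ : ℤ_[p]ˣ) : ℤ_[p]) =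
            (cyclotomicGenerator p : ℤ_[p])) ∧
        ∀ s : Kobayashi2003.signedSelmerInfty V' κF 1,
          ((Φ ⟨V'.conjH1 p κF.kerSubgroup γF s,
              Kobayashi2003.conjH1_mem_signedSelmerInfty V' κF 1 γF s.2⟩).1 : V.subgroupH1 p κ.kerSubgroup) =
            V.conjH1 p κ.kerSubgroup γ (Φ s).1 ∧
          ((Φ ⟨V'.conjH1 p κF.kerSubgroup γF s,
              Kobayashi2003.conjH1_mem_signedSelmerInfty V' κF 1 γF s.2⟩).2 :
              V.subgroupH1 p (towerTopSubgroup κ K₀)) =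
            V.conjH1 p (towerTopSubgroup κ K₀) γ (Φ s).2 := by
  intro p _ hp5 K₀ _ _ _ _ ηq hηK hη1 V _ _ hgood hap κ γ hκ hγ hγK hγc
  have hpP : p.Prime := Fact.out
  have hp2 : p ≠ 2 := by omega
  obtain ⟨F, _iF, _iNF, _iN, θF, V', _iE, κF, γF, ΨA, h2, hθF, hcF, hCV', hκF, hγF, hζ, hδ, hΨA⟩ :=
    hA p hp5 K₀ ηq hηK hη1 V hgood hap κ γ hκ hγ hγK hγc
  -- `√p* ∈ K₀` (Gauss) and the sign-character binders at `K₀` and at `F`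
  have hc0 : ((-1 : ℚ) ^ (p / 2) * p) ≠ 0 :=
    mul_ne_zero (pow_ne_zero _ (by norm_num)) (Nat.cast_ne_zero.mpr hpP.ne_zero)
  obtain ⟨θ₀, hθ₀2⟩ := exists_sq_eq_pStar p K₀ hp2
  have hc₀ : θ₀ ^ 2 = algebraMap ℚ K₀ ((-1) ^ (p / 2) * p) := by
    rw [hθ₀2, map_mul, map_pow, map_neg, map_one, map_natCast]
  have hθ₀ : θ₀ ∉ Set.range (algebraMap ℚ K₀) := by
    rintro ⟨q, hq⟩
    apply forall_sq_ne_pStar p q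
    apply (algebraMap ℚ K₀).injective
    rw [map_pow, hq, hc₀]
  have hηK₀ : ∀ σ, ηq σ = 1 ↔ σ • rootInClosure K₀ θ₀ = rootInClosure K₀ θ₀ :=
    eta_eq_one_iff_smul_rootInClosure p K₀ hθ₀ hc₀ ηq hηK hη1
  have hηF : ∀ σ, ηq σ = 1 ↔ σ • rootInClosure F θF = rootInClosure F θF :=
    eta_eq_one_iff_smul_rootInClosure_of_sq_eq p K₀ ηq F hηK hη1 hcF hθ₀ hc₀
  have hFη : ∀ σ, σ ∈ galRange (K := ℚ) F ↔ ηq σ = 1 :=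
    mem_galRange_iff_eta_eq_one p K₀ ηq F h2 hθF hcF hηK hη1 hθ₀ hc₀
  -- the (P5) binders at `K₀` and at `F`
  have hDK := localTowerHyp_padic p κ K₀ hκ
  have hDF := localTowerHyp_padic_of_sq_eq p K₀ ηq F κ hκ h2 hθF hcF hηK hη1 hθ₀ hc₀
  have hκK : ∀ x, ∃ g ∈ galRange (K := ℚ) K₀, κ g = x := kappa_surjOn_galRange_cyclotomic κ K₀
  haveI : IsGalois ℚ F := isGalois_of_finrank_eq_two F h2
  have hcopF' : p.Coprime (Module.finrank ℚ F) := by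
    rw [h2]; exact (Nat.coprime_primes hpP Nat.prime_two).mpr hp2
  have hκF' : ∀ x, ∃ g ∈ galRange (K := ℚ) F, κ g = x :=
    kappa_surjOn_galRange_of_coprime_finrank κ F hcopF'
  have hcopK : (galRange (K := ℚ) K₀).index.Coprime p := coprime_index_galRange_cyclotomic p K₀
  have hcopF : (galRange (K := ℚ) F).index.Coprime p := by
    rw [RelModel.index_galRange (K := ℚ) F, h2]
    exact (Nat.coprime_primes Nat.prime_two hpP).mpr hp2.symm
  -- the twist partner `W = V^{(p*)}`
  obtain ⟨C, hCV⟩ := exists_variableChange_twist_twist V hc0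
  have hCW : (1 : VariableChange ℚ) • V.quadraticTwist ((-1) ^ (p / 2) * p) =
      V.quadraticTwist ((-1) ^ (p / 2) * p) := one_smul _ _
  -- (B1) at `F`
  have hηker : ∀ σ ∈ κ.kerSubgroup, ηq σ = 1 → σ ∈ galRange (K := ℚ) F :=
    fun σ _ h => (hFη σ).mpr h
  have hτ := exists_mem_kerSubgroup_eta_ne_one p K₀ ηq F κ hp2 h2 hθF hcF hηK hη1 hθ₀ hc₀
  obtain ⟨Ψ₁, hΨ₁⟩ :=
    exists_addEquiv_prod_towerSignedSelmerInftyEta V κ F ηq ℚ_[p] 1 hp2 hηker hτ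
  -- (B2⁰) at `F` and (i-f)
  obtain ⟨Ψ₂, hΨ₂⟩ := exists_addEquiv_strictSignedSelmerInfty_towerEta_one
    (V.quadraticTwist ((-1) ^ (p / 2) * p)) p κ ℚ_[p] ηq F hθF hcF hCV hCW hηF hDF hκF' hcopF
  have hS₀ : Kobayashi2003.signedSelmerInfty V κ 1 = strictSignedSelmerInfty V κ ℚ_[p] 1 :=
    hIF p hp5 V hgood hap κ hκ
  obtain ⟨e₀, he₀⟩ : ∃ e : Kobayashi2003.signedSelmerInfty V κ 1 ≃+ strictSignedSelmerInfty V κ ℚ_[p] 1,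
      ∀ z, ((e.symm z : Kobayashi2003.signedSelmerInfty V κ 1) : V.subgroupH1 p κ.kerSubgroup) = z :=
    ⟨AddEquiv.addSubgroupCongr hS₀, fun z => AddEquiv.addSubgroupCongr_symm_apply hS₀ z⟩
  -- (B3) at `(F, K₀)`
  obtain ⟨Ψ₃, hΨ₃⟩ := exists_addEquiv_towerSignedSelmerInftyEta_of_two_fields
    (V.quadraticTwist ((-1) ^ (p / 2) * p)) p κ ℚ_[p] ηq F K₀ hθF hcF hθ₀ hc₀ hCV hηF hηK₀
    hDF hDK hκF' hκK hcopF hcopK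
  -- the decomposition
  obtain ⟨Φ, hΦ⟩ : ∃ Φ : Kobayashi2003.signedSelmerInfty V' κF 1 ≃+
      Kobayashi2003.signedSelmerInfty V κ 1 × towerSignedSelmerInftyEta V κ K₀ ℚ_[p] ηq 1,
      ∀ x, Φ x = (e₀.symm (Ψ₂.symm (Ψ₁.symm (ΨA x)).1), Ψ₃ (Ψ₁.symm (ΨA x)).2) :=
    ⟨ΨA.trans (Ψ₁.symm.trans (AddEquiv.prodCongr (Ψ₂.symm.trans e₀.symm) Ψ₃)), fun x => by
      rw [addEquiv_trans_symm_trans_prodCongr_apply, AddEquiv.trans_apply]⟩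
  refine ⟨F, _iF, _iNF, V', _iE, κF, γF, Φ, h2, ⟨θF, hcF⟩, hCV', hκF, hγF, hζ, fun s => ?_⟩
  -- `conj_{g'} = conj_γ` on the two targets, `g' = γF|_{ℚ̄}`, `γ⁻¹ g' ∈ ker κ ∩ ker ηq`
  set g' := resGal (K := ℚ) F γF with hg'
  have hg'F : g' ∈ galRange (K := ℚ) F := (mem_galRange_iff F g').mpr ⟨γF, rfl⟩
  have hηδ : ((ηq (γ⁻¹ * g') : ℤˣ) : ℤ) = 1 := by
    rw [map_mul, map_inv, hηK γ hγK, (hFη g').mp hg'F, inv_one, one_mul, Units.val_one]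
  have hgg : g' = γ * (γ⁻¹ * g') := by rw [mul_inv_cancel_left]
  have hconj₀ : ∀ x : V.subgroupH1 p κ.kerSubgroup,
      V.conjH1 p κ.kerSubgroup g' x = V.conjH1 p κ.kerSubgroup γ x := fun x => by
    rw [hgg, V.conjH1_mul_holds p κ.kerSubgroup, AddMonoidHom.comp_apply,
      V.conjH1_of_mem_holds p κ.kerSubgroup hδ, AddMonoidHom.id_apply]
  have hconjη : ∀ y : towerSignedSelmerInftyEta V κ K₀ ℚ_[p] ηq 1,
      V.conjH1 p (towerTopSubgroup κ K₀) g' (y : V.subgroupH1 p (towerTopSubgroup κ K₀)) =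
        V.conjH1 p (towerTopSubgroup κ K₀) γ y := fun y => by
    rw [hgg, V.conjH1_mul_holds p (towerTopSubgroup κ K₀), AddMonoidHom.comp_apply,
      ((mem_towerSignedSelmerInftyEta_iff V κ K₀ ℚ_[p] ηq 1 _).mp y.2).2 _ hδ, hηδ, one_zsmul]
  -- `Ψ_A` and `Ψ₁⁻¹` on `conj`
  have step1 : ΨA ⟨V'.conjH1 p κF.kerSubgroup γF s, Kobayashi2003.conjH1_mem_signedSelmerInfty V' κF 1 γF s.2⟩ =
      ⟨V.conjH1 p (towerTopSubgroup κ F) g' (ΨA s),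
        conjH1_mem_towerSignedSelmerInfty V κ F ℚ_[p] 1 g' (ΨA s).2⟩ :=
    Subtype.ext (hΨA s)
  have step2 := addEquiv_prod_towerSignedSelmerInftyEta_symm_conjH1 V κ F ηq ℚ_[p] 1 Ψ₁ hΨ₁ g' (ΨA s)
  -- `Ψ₂⁻¹` on `conj`
  have step3 : ∀ a : towerSignedSelmerInftyEta V κ F ℚ_[p] 1 1,
      ((Ψ₂.symm ⟨V.conjH1 p (towerTopSubgroup κ F) g' (a : V.subgroupH1 p (towerTopSubgroup κ F)),
          conjH1_mem_towerSignedSelmerInftyEta V κ F ℚ_[p] 1 1 g' a.2⟩ :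
          strictSignedSelmerInfty V κ ℚ_[p] 1) : V.subgroupH1 p κ.kerSubgroup) =
        V.conjH1 p κ.kerSubgroup g' (Ψ₂.symm a : strictSignedSelmerInfty V κ ℚ_[p] 1) := by
    intro a
    have h := hΨ₂ g' (Ψ₂.symm a)
    rw [AddEquiv.apply_symm_apply] at h
    have h' : Ψ₂ ⟨V.conjH1 p κ.kerSubgroup g' (Ψ₂.symm a : strictSignedSelmerInfty V κ ℚ_[p] 1),
        conjH1_mem_strictSignedSelmerInfty V κ ℚ_[p] 1 g' (Ψ₂.symm a).2⟩ =
        ⟨V.conjH1 p (towerTopSubgroup κ F) g' (a : V.subgroupH1 p (towerTopSubgroup κ F)),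
          conjH1_mem_towerSignedSelmerInftyEta V κ F ℚ_[p] 1 1 g' a.2⟩ := Subtype.ext h
    rw [← h', AddEquiv.symm_apply_apply]
  refine ⟨?_, ?_⟩
  · rw [hΦ, hΦ, step1, step2, he₀, he₀, step3, hconj₀]
  · rw [hΦ, hΦ, step1, step2]
    change ((Ψ₃ ⟨V.conjH1 p (towerTopSubgroup κ F) g' ((Ψ₁.symm (ΨA s)).2 : V.subgroupH1 p (towerTopSubgroup κ F)),
        conjH1_mem_towerSignedSelmerInftyEta V κ F ℚ_[p] ηq 1 g' (Ψ₁.symm (ΨA s)).2.2⟩ :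
        towerSignedSelmerInftyEta V κ K₀ ℚ_[p] ηq 1) : V.subgroupH1 p (towerTopSubgroup κ K₀)) =
      V.conjH1 p (towerTopSubgroup κ K₀) γ (Ψ₃ (Ψ₁.symm (ΨA s)).2)
    rw [hΨ₃, hconjη]

end Summit.BirchSwinnertonDyer.BirchSwinnertonDyer.Theorems

end
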